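import Summits.SmoothPoincare4.SmoothPoincare4.Theses.EntropyRung
import Literature.Geometry.Lorentzian.DalembertianCompose
import Literature.Geometry.Lorentzian.AFLinearUniqueness
import Literature.Geometry.Lorentzian.MassCapacityHarmonic
import Literature.Geometry.Lorentzian.BlackHoles
import Literature.Geometry.Riemannian.PerelmanEntropyCutoff
import Mathlib.Analysis.Calculus.Deriv.MeanValue
import HarnessLib

/-!
# The truncated Green function as a conformal factor: `ψ = θ(G) + η u₀` has `L_g ψ ≥ η`
(helper H4 for stub `stub_conformalGluing` of line `green-blowup-conformal-entropy`, crux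
`EntropyRung.SubcylindricalExistence`, item stmt-SmoothPoincare4-10871)

Let `g` be a smooth Riemannian metric (Levi-Civita) of POSITIVE scalar curvature on a 4-manifold
of the summit binder, `(p, G)` Green data (`G` smooth and positive off `p`, `R G − 6 Δ G = 0` off
`p`, `G → +∞` at `p`), `u₀` a smooth positive solution of `L_g u₀ = R u₀ − 6 Δ u₀ = 1`, and
`θ : ℝ → ℝ` smooth, nondecreasing (`θ' ≥ 0`), concave (`θ'' ≤ 0`), `θ(0) ≥ 0` and constant on
`[S, ∞)`. Then the function `ψ(x) = θ(G x) + η u₀ x` (with `θ(G p) := θ(S)`) is smooth and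
positive on all of `M` and `L_g ψ = R ψ − 6 Δ_g ψ ≥ η` everywhere (`capFactor_contMDiff`,
`capFactor_pos`, `eta_le_conformalLaplacian_capFactor`): off `p`,
`L_g(θ∘G) = R (θ(G) − G θ'(G)) − 6 θ''(G) |∇G|² ≥ 0` by the chain rule for `Δ_g`
(`dalembertian_real_comp`), the Green equation `Δ G = R G/6`, concavity (`θ(s) − s θ'(s) ≥ θ(0)`)
and `R > 0`; at `p` the function `θ∘G` is locally constant. This is the bubble-free conformal
factor of the lead's architecture for Stub D (the AE end of the blow-up `G² g` capped by a flat
disc: `ψ² g = (G + η u₀)² g ≈ G² g` on `{G ≤ K}` for `θ(s) = s` there). References: Schoen–Yau 1979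
§2 Step 1 (concave functions of superharmonic functions, the device of `dalembertian_real_comp_nonpos`);
Lee–Parker 1987 §2 (conformal Laplacian `L_g = −6Δ_g + R_g` in dimension 4).
-/

noncomputable section

-- the registered namespace `Summit.SmoothPoincare4.SmoothPoincare4.Theorems` repeats a component
set_option linter.dupNamespace false

open scoped Manifold ContDiff Topology
open Set Filter
open Literature.Geometry.Lorentzian Literature.Geometry.Riemannian

namespace Summit.SmoothPoincare4.SmoothPoincare4.Theorems

namespace CapFactor

/-! ### One-variable facts about the profile `θ` -/

/-- A smooth concave (`θ'' ≤ 0`) function satisfies `θ(s) − s θ'(s) ≥ θ(0)` for `s ≥ 0`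
(mean value theorem and antitonicity of `θ'`). -/
theorem sub_mul_deriv_ge {θ : ℝ → ℝ} (hθ : ContDiff ℝ ∞ θ) (hconc : ∀ s, deriv (deriv θ) s ≤ 0)
    {s : ℝ} (hs : 0 ≤ s) : θ 0 ≤ θ s - s * deriv θ s := by
  have hd : Differentiable ℝ θ := hθ.differentiable (by simp)
  have hd' : Differentiable ℝ (deriv θ) := by
    have := hθ.iterate_deriv 1
    exact (this.differentiable (by simp))
  have hanti : Antitone (deriv θ) := antitone_of_deriv_nonpos hd' hconc
  rcases hs.eq_or_lt with rfl | hpos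
  · simp
  obtain ⟨ξ, hξ, hslope⟩ := exists_deriv_eq_slope θ hpos hd.continuous.continuousOn
    (hd.differentiableOn.mono Ioo_subset_Icc_self)
  have h1 : deriv θ s ≤ deriv θ ξ := hanti hξ.2.le
  rw [hslope, le_div_iff₀ (by linarith), sub_zero] at h1
  linarith

/-- A smooth nondecreasing function with `θ(0) ≥ 0` is nonnegative on `[0, ∞)`. -/
theorem nonneg_of_monotone {θ : ℝ → ℝ} (hθ : ContDiff ℝ ∞ θ) (hmono : ∀ s, 0 ≤ deriv θ s)
    (h0 : 0 ≤ θ 0) {s : ℝ} (hs : 0 ≤ s) : 0 ≤ θ s :=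
  h0.trans (monotone_of_deriv_nonneg (hθ.differentiable (by simp)) hmono hs)

/-! ### The conformal factor -/

variable {M : Type} [TopologicalSpace M] [T2Space M]
  [ChartedSpace (EuclideanSpace ℝ (Fin 4)) M] [IsManifold (𝓡 4) ∞ M]
  (g : PseudoRiemannianMetric (𝓡 4) ∞ (EuclideanSpace ℝ (Fin 4)) (TangentSpace (𝓡 4) : M → Type _))
  [g.HasLeviCivita]

omit [T2Space M] in
/-- `Δ_g (c · u) = c · Δ_g u` for `u` of class `C²` at `x` (chain rule with the linear profile). -/
theorem dalembertian_const_mul {u : M → ℝ} {x : M} (hu : ContMDiffAt (𝓡 4) 𝓘(ℝ, ℝ) 2 u x) (c : ℝ) :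
    g.dalembertian (fun y ↦ c * u y) x = c * g.dalembertian u x := by
  have h := g.dalembertian_real_comp (ζ := fun t ↦ c * t) hu
    ((contDiff_const.mul contDiff_id).contDiffAt)
  have hd : deriv (fun t : ℝ ↦ c * t) = fun _ ↦ c := by
    funext t
    simp
  rw [show (fun y ↦ c * u y) = (fun t : ℝ ↦ c * t) ∘ u from rfl, h, hd]
  simp

omit [T2Space M] in
/-- `Δ_g (u + v) = Δ_g u + Δ_g v` for `u, v` of class `C²` at `x`. -/
theorem dalembertian_add {u v : M → ℝ} {x : M} (hu : ContMDiffAt (𝓡 4) 𝓘(ℝ, ℝ) 2 u x)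
    (hv : ContMDiffAt (𝓡 4) 𝓘(ℝ, ℝ) 2 v x) :
    g.dalembertian (fun y ↦ u y + v y) x = g.dalembertian u x + g.dalembertian v x := by
  have h := dalembertian_sub g (f₁ := fun y ↦ u y + v y) (f₂ := v) (hu.add hv) hv
  have hfun : ((fun y ↦ u y + v y) - v) = u := by
    funext y
    simp
  rw [hfun] at h
  linarith

section Construction

open scoped Classical

variable {p : M} {G : M → ℝ} {θ : ℝ → ℝ} {S : ℝ}

omit [T2Space M] [ChartedSpace (EuclideanSpace ℝ (Fin 4)) M] [IsManifold (𝓡 4) ∞ M] [g.HasLeviCivita] in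
/-- Near the pole, the extended profile `x ↦ if x = p then θ S else θ (G x)` is the constant
`θ(S)` (because `G → +∞` at `p` and `θ` is constant on `[S, ∞)`). -/
theorem capProfile_eventuallyEq_const (hGlim : Tendsto G (𝓝[≠] p) atTop)
    (hθS : ∀ s, S ≤ s → θ s = θ S) :
    (fun x : M ↦ if x = p then θ S else θ (G x)) =ᶠ[𝓝 p] fun _ ↦ θ S := by
  have h1 : ∀ᶠ x in 𝓝[≠] p, S ≤ G x := hGlim.eventually (eventually_ge_atTop S)
  have h2 : ∀ᶠ x in 𝓝[≠] p, (if x = p then θ S else θ (G x)) = θ S := by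
    filter_upwards [h1, self_mem_nhdsWithin] with x hx hxp
    rw [if_neg (by simpa using hxp), hθS _ hx]
  rw [eventually_nhdsWithin_iff] at h2
  filter_upwards [h2] with x hx
  by_cases hxp : x = p
  · subst hxp
    simp
  · exact hx hxp

omit [T2Space M] [ChartedSpace (EuclideanSpace ℝ (Fin 4)) M] [IsManifold (𝓡 4) ∞ M] [g.HasLeviCivita] in
/-- Off the pole, the extended profile agrees with `θ ∘ G` near every point (`M` is `T₁`). -/
theorem capProfile_eventuallyEq_comp [T1Space M] {x : M} (hx : x ≠ p) :
    (fun x : M ↦ if x = p then θ S else θ (G x)) =ᶠ[𝓝 x] (θ ∘ G) := by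
  have hopen : IsOpen ({p}ᶜ : Set M) := isOpen_compl_singleton
  filter_upwards [hopen.mem_nhds (by simpa using hx)] with y hy
  have hyp : y ≠ p := by simpa using hy
  simp [hyp]

omit [IsManifold (𝓡 4) ∞ M] [g.HasLeviCivita] in
/-- **Smoothness** of the extended profile `θ ∘ G`. -/
theorem capProfile_contMDiff (hGs : ContMDiffOn (𝓡 4) 𝓘(ℝ, ℝ) ∞ G {p}ᶜ)
    (hGlim : Tendsto G (𝓝[≠] p) atTop) (hθ : ContDiff ℝ ∞ θ) (hθS : ∀ s, S ≤ s → θ s = θ S) :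
    ContMDiff (𝓡 4) 𝓘(ℝ, ℝ) ∞ (fun x : M ↦ if x = p then θ S else θ (G x)) := by
  intro x
  by_cases hx : x = p
  · subst hx
    exact contMDiffAt_const.congr_of_eventuallyEq (capProfile_eventuallyEq_const hGlim hθS)
  · have hG : ContMDiffAt (𝓡 4) 𝓘(ℝ, ℝ) ∞ G x :=
      (hGs x (by simpa using hx)).contMDiffAt (isOpen_compl_singleton.mem_nhds (by simpa using hx))
    have hcomp : ContMDiffAt (𝓡 4) 𝓘(ℝ, ℝ) ∞ (θ ∘ G) x := hθ.contDiffAt.comp_contMDiffAt hG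
    exact hcomp.congr_of_eventuallyEq (capProfile_eventuallyEq_comp hx)

/-- `θ(S) ≥ 0` for a nondecreasing `θ` with `θ(0) ≥ 0` that is constant on `[S, ∞)`. -/
theorem capProfile_pole_nonneg (hθ : ContDiff ℝ ∞ θ) (hmono : ∀ s, 0 ≤ deriv θ s) (hθ0 : 0 ≤ θ 0)
    (hθS : ∀ s, S ≤ s → θ s = θ S) : 0 ≤ θ S := by
  by_cases hS : 0 ≤ S
  · exact nonneg_of_monotone hθ hmono hθ0 hS
  · have : θ 0 = θ S := hθS 0 (le_of_lt (not_le.mp hS))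
    rw [← this]
    exact hθ0

/-- **The conformal Laplacian of the extended profile is nonnegative**: for `R > 0`, Green data
`(p, G)` and `θ` smooth nondecreasing concave with `θ(0) ≥ 0`, constant on `[S, ∞)`,
`0 ≤ R · (θ∘G) − 6 Δ_g (θ∘G)` at every point (chain rule `Δ(θ∘G) = θ''|∇G|² + θ' ΔG`,
`ΔG = R G/6`, `θ(G) − G θ'(G) ≥ 0`, `θ'' ≤ 0`; at `p` the profile is locally constant). -/
theorem conformalLaplacian_capProfile_nonneg (hg : g.IsRiemannian)
    (hR : ∀ x, 0 < g.scalarCurvature x)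
    (hGs : ContMDiffOn (𝓡 4) 𝓘(ℝ, ℝ) ∞ G {p}ᶜ) (hGpos : ∀ x, x ≠ p → 0 < G x)
    (hGreen : ∀ x, x ≠ p → g.scalarCurvature x * G x - 6 * g.dalembertian G x = 0)
    (hGlim : Tendsto G (𝓝[≠] p) atTop) (hθ : ContDiff ℝ ∞ θ) (hmono : ∀ s, 0 ≤ deriv θ s)
    (hconc : ∀ s, deriv (deriv θ) s ≤ 0) (hθ0 : 0 ≤ θ 0) (hθS : ∀ s, S ≤ s → θ s = θ S) (x : M) :
    0 ≤ g.scalarCurvature x * (if x = p then θ S else θ (G x))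
      - 6 * g.dalembertian (fun y : M ↦ if y = p then θ S else θ (G y)) x := by
  by_cases hx : x = p
  · subst hx
    rw [g.dalembertian_congr_of_eventuallyEq (capProfile_eventuallyEq_const hGlim hθS),
      g.dalembertian_const (θ S) x, if_pos rfl, mul_zero, sub_zero]
    exact mul_nonneg (hR x).le (capProfile_pole_nonneg hθ hmono hθ0 hθS)
  · have hGx : ContMDiffAt (𝓡 4) 𝓘(ℝ, ℝ) ∞ G x :=
      (hGs x (by simpa using hx)).contMDiffAt (isOpen_compl_singleton.mem_nhds (by simpa using hx))
    have hG2 : ContMDiffAt (𝓡 4) 𝓘(ℝ, ℝ) 2 G x := hGx.of_le (WithTop.coe_le_coe.mpr le_top)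
    rw [g.dalembertian_congr_of_eventuallyEq (capProfile_eventuallyEq_comp hx), if_neg hx,
      g.dalembertian_real_comp hG2 (hθ.contDiffAt.of_le (WithTop.coe_le_coe.mpr le_top))]
    -- `ΔG = R G / 6`
    have hΔG : g.dalembertian G x = g.scalarCurvature x * G x / 6 := by
      have := hGreen x hx
      linarith
    rw [hΔG]
    have hI : 0 ≤ g.innerDual x (mvfderiv (𝓡 4) G x).toLinearMap (mvfderiv (𝓡 4) G x).toLinearMap :=
      g.innerDual_self_nonneg hg x _
    have hkey : θ 0 ≤ θ (G x) - G x * deriv θ (G x) := sub_mul_deriv_ge hθ hconc (hGpos x hx).le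
    have hRx := hR x
    -- `R θ(G) − 6(θ''|∇G|² + θ' R G/6) = R(θ(G) − G θ') − 6 θ''|∇G|² ≥ 0`
    have hA : 0 ≤ g.scalarCurvature x * (θ (G x) - G x * deriv θ (G x)) :=
      mul_nonneg hRx.le (hθ0.trans hkey)
    have hB : 0 ≤ -deriv (deriv θ) (G x) *
        g.innerDual x (mvfderiv (𝓡 4) G x).toLinearMap (mvfderiv (𝓡 4) G x).toLinearMap :=
      mul_nonneg (neg_nonneg.mpr (hconc (G x))) hI
    nlinarith [hA, hB]

/-- **`ψ = θ(G) + η u₀` has `L_g ψ ≥ η`**: the construction lemma H4 of the lead's architecture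
for Stub D (`u₀` a smooth solution of `L_g u₀ = R u₀ − 6 Δ u₀ = 1`). -/
theorem eta_le_conformalLaplacian_capFactor (hg : g.IsRiemannian)
    (hR : ∀ x, 0 < g.scalarCurvature x)
    (hGs : ContMDiffOn (𝓡 4) 𝓘(ℝ, ℝ) ∞ G {p}ᶜ) (hGpos : ∀ x, x ≠ p → 0 < G x)
    (hGreen : ∀ x, x ≠ p → g.scalarCurvature x * G x - 6 * g.dalembertian G x = 0)
    (hGlim : Tendsto G (𝓝[≠] p) atTop) (hθ : ContDiff ℝ ∞ θ) (hmono : ∀ s, 0 ≤ deriv θ s)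
    (hconc : ∀ s, deriv (deriv θ) s ≤ 0) (hθ0 : 0 ≤ θ 0) (hθS : ∀ s, S ≤ s → θ s = θ S)
    {u₀ : M → ℝ} (hu₀ : ContMDiff (𝓡 4) 𝓘(ℝ, ℝ) ∞ u₀)
    (hLu₀ : ∀ x, g.scalarCurvature x * u₀ x - 6 * g.dalembertian u₀ x = 1) (η : ℝ) (x : M) :
    η ≤ g.scalarCurvature x * ((if x = p then θ S else θ (G x)) + η * u₀ x)
      - 6 * g.dalembertian (fun y : M ↦ (if y = p then θ S else θ (G y)) + η * u₀ y) x := by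
  have hψ₀ := capProfile_contMDiff hGs hGlim hθ hθS
  have h2ψ₀ : ContMDiffAt (𝓡 4) 𝓘(ℝ, ℝ) 2 (fun y : M ↦ if y = p then θ S else θ (G y)) x :=
    (hψ₀ x).of_le (WithTop.coe_le_coe.mpr le_top)
  have h2u : ContMDiffAt (𝓡 4) 𝓘(ℝ, ℝ) 2 (fun y ↦ η * u₀ y) x :=
    ((contMDiff_const.mul hu₀) x).of_le (WithTop.coe_le_coe.mpr le_top)
  rw [dalembertian_add g h2ψ₀ h2u, dalembertian_const_mul g ((hu₀ x).of_le (WithTop.coe_le_coe.mpr le_top)) η]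
  have h0 := conformalLaplacian_capProfile_nonneg g hg hR hGs hGpos hGreen hGlim hθ hmono hconc
    hθ0 hθS x
  have h1 := hLu₀ x
  have hsplit : g.scalarCurvature x * ((if x = p then θ S else θ (G x)) + η * u₀ x)
      - 6 * (g.dalembertian (fun y : M ↦ if y = p then θ S else θ (G y)) x
        + η * g.dalembertian u₀ x)
      = (g.scalarCurvature x * (if x = p then θ S else θ (G x))
          - 6 * g.dalembertian (fun y : M ↦ if y = p then θ S else θ (G y)) x)
        + η * (g.scalarCurvature x * u₀ x - 6 * g.dalembertian u₀ x) := by ring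
  rw [hsplit, h1]
  linarith [h0]

omit [TopologicalSpace M] [T2Space M] [ChartedSpace (EuclideanSpace ℝ (Fin 4)) M] [IsManifold (𝓡 4) ∞ M] [g.HasLeviCivita] in
/-- **Positivity of `ψ = θ(G) + η u₀`** for `η > 0`, `u₀ > 0`. -/
theorem capFactor_pos (hGpos : ∀ x, x ≠ p → 0 < G x) (hθ : ContDiff ℝ ∞ θ)
    (hmono : ∀ s, 0 ≤ deriv θ s) (hθ0 : 0 ≤ θ 0) (hθS : ∀ s, S ≤ s → θ s = θ S)
    {u₀ : M → ℝ} (hu₀pos : ∀ x, 0 < u₀ x) {η : ℝ} (hη : 0 < η) (x : M) :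
    0 < (if x = p then θ S else θ (G x)) + η * u₀ x := by
  have hpos : 0 < η * u₀ x := mul_pos hη (hu₀pos x)
  have hnn : 0 ≤ (if x = p then θ S else θ (G x)) := by
    by_cases hx : x = p
    · rw [if_pos hx]
      exact capProfile_pole_nonneg hθ hmono hθ0 hθS
    · rw [if_neg hx]
      exact nonneg_of_monotone hθ hmono hθ0 (hGpos x hx).le
  linarith

end Construction

end CapFactor

/-- **The truncated Green function as a conformal factor, registered form** (summit binder; helper
H4 for stub `stub_conformalGluing` of line `green-blowup-conformal-entropy`, crux
stmt-SmoothPoincare4-10871): for `R > 0`, Green data `(p, G)`, a smooth positive solution `u₀` of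
`L_g u₀ = 1`, a smooth nondecreasing concave profile `θ` with `θ(0) ≥ 0` constant on `[S, ∞)`,
and `η > 0`, there is a smooth positive `ψ` with `L_g ψ = R ψ − 6 Δ_g ψ ≥ η`, equal to
`θ(G) + η u₀` off `p` and to `θ(S) + η u₀(p)` at `p`. Schoen–Yau 1979 §2 Step 1; Lee–Parker 1987 §2. -/
theorem capFactor_exists :
    ∀ (M : Type) [TopologicalSpace M] [T2Space M] [SecondCountableTopology M]
      [ChartedSpace (EuclideanSpace ℝ (Fin 4)) M] [IsManifold (𝓡 4) ∞ M] [CompactSpace M]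
      [T3Space M] [MeasurableSpace M] [BorelSpace M]
      (g : PseudoRiemannianMetric (𝓡 4) ∞ (EuclideanSpace ℝ (Fin 4)) (TangentSpace (𝓡 4) : M → Type _))
      [g.HasLeviCivita], g.IsRiemannian → (∀ x, 0 < g.scalarCurvature x) →
      ∀ (p : M) (G : M → ℝ),
        (ContMDiffOn (𝓡 4) 𝓘(ℝ, ℝ) ∞ G {p}ᶜ ∧ (∀ x, x ≠ p → 0 < G x) ∧
          (∀ x, x ≠ p → g.scalarCurvature x * G x - 6 * g.dalembertian G x = 0) ∧
          Tendsto G (𝓝[≠] p) atTop) →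
      ∀ (u₀ : M → ℝ), ContMDiff (𝓡 4) 𝓘(ℝ, ℝ) ∞ u₀ → (∀ x, 0 < u₀ x) →
        (∀ x, g.scalarCurvature x * u₀ x - 6 * g.dalembertian u₀ x = 1) →
      ∀ (θ : ℝ → ℝ) (S : ℝ), ContDiff ℝ ∞ θ → (∀ s, 0 ≤ deriv θ s) →
        (∀ s, deriv (deriv θ) s ≤ 0) → 0 ≤ θ 0 → (∀ s, S ≤ s → θ s = θ S) →
      ∀ (η : ℝ), 0 < η →
        ∃ ψ : M → ℝ, ContMDiff (𝓡 4) 𝓘(ℝ, ℝ) ∞ ψ ∧ (∀ x, 0 < ψ x) ∧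
          (∀ x, η ≤ g.scalarCurvature x * ψ x - 6 * g.dalembertian ψ x) ∧
          (∀ x, x ≠ p → ψ x = θ (G x) + η * u₀ x) ∧ ψ p = θ S + η * u₀ p := by
  classical
  intro M _ _ _ _ _ _ _ _ _ g _ hg hR p G hGreen u₀ hu₀ hu₀pos hLu₀ θ S hθ hmono hconc hθ0 hθS η hη
  obtain ⟨hGs, hGpos, hGeq, hGlim⟩ := hGreen
  refine ⟨fun x ↦ (if x = p then θ S else θ (G x)) + η * u₀ x, ?_, ?_, ?_, ?_, ?_⟩
  · exact (CapFactor.capProfile_contMDiff hGs hGlim hθ hθS).add (contMDiff_const.mul hu₀)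
  · exact fun x ↦ CapFactor.capFactor_pos hGpos hθ hmono hθ0 hθS hu₀pos hη x
  · exact fun x ↦ CapFactor.eta_le_conformalLaplacian_capFactor g hg hR hGs hGpos hGeq hGlim hθ hmono
      hconc hθ0 hθS hu₀ hLu₀ η x
  · intro x hx
    simp [hx]
  · simp

end Summit.SmoothPoincare4.SmoothPoincare4.Theorems

end
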